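import Summits.ValiantsHypothesis.ValiantsHypothesis.Theorems.FeketeSOSFeketeSOSHardPaleyRIPDirectSumParseval
import Summits.ValiantsHypothesis.ValiantsHypothesis.Theorems.FeketeSOSFeketeSOSHardPaleyRIPPairing

/-!
# Route FeketeSOS — crux `FeketeSOSHard` (stmt-ValiantsHypothesis-3996), line `paley-rip` v3:
# `stub_tameOperator` HOLDS ON DIRECT SUMSETS `D + [0,k)` (all ranks, exponent 1, constant `√r (⌊log₂k⌋ + 5/2)`)

The theorem of `Cruxes/FeketeSOSHard/TameOperatorDplusH.md` (census §9, seat val-width-3996-p2: mathematics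
modulo Takagi) in kernel, along the Takagi-free route of `Cruxes/FeketeSOSHard/Lines/paley-rip-pieceB-interval.md`
(seat p3) — with the BETTER constant `√r` of the original (balanced polarisation, `…PaleyRIPSymOuterNuclear.lean`)
and `log₂ k + 5/2` in place of `‖R_k‖_{S₁}` (`exp_rep`, piece (B)):

* `tameOperator_directSum_l2` — let `k ≥ 1` and let `D ⊂ ℕ` have the SIDON-TYPE SPACING relative to
  `[0, 2k−1)`: all `d + d' + f` (`{d,d'} ⊆ D`, `f < 2k−1`) are distinct up to the swap `d ↔ d'` (equivalently:
  `D` is Sidon and the blocks `(d + d') + [0, 2k−1)` are pairwise disjoint; it makes `S = D + [0,k)` direct).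
  Then every family of `r` weighted squares `(c_i, w_i)` supported in `S` has a re-representation by weighted
  squares supported in `S` with the SAME pattern `y = Σ_i c_i w_i²` and archimedean mass
  `Σ_j |c'_j|‖w'_j‖₂² ≤ √r · (Nat.log 2 k + 5/2) · ‖y‖₂`, `‖y‖₂ = (Σ_{n ∈ supp y} |y_n|²)^{1/2}`;
* `tameOperator_directSum_sup` — `… ≤ √r · (Nat.log 2 k + 5/2) · #S · max_n |y_n|`;
* `tameOperator_of_directSum` — THE STUB'S VOCABULARY (cyclic patterns): if the spacing holds MODULO a prime `p`,
  and `X^p − 1 ∣ Σ_i c_i w_i² − F`, `deg F < p`, `|F_n| ≤ M`, then there are weighted squares supported in `S`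
  with `X^p − 1 ∣ Σ_j c'_j w'_j² − F` and mass `≤ √r · (Nat.log 2 k + 5/2) · #S · M` — i.e. the conclusion of
  `stub_tameOperator` with `K r^K #S^{1+ε} M` replaced by `√r (log₂ k + 5/2) #S M` (exponent `1`, no `ε`);
* `tameOperator_of_sidon` — the case `k = 1`: ALL RANKS on Sidon-mod-`p` supports, mass `≤ √r · (5/2) · #S · M`
  (cf. `tameOperator_rank_two_of_sidon`, `r = 2`, constant `2`).

Proof: `directSum_rep_frobenius` (rows along `D`, DFT per block pair, `lowRank_rep` = ONB + balanced
polarisation at each frequency, `rep_mul` with `exp_rep`) and `frobenius_sum_le_l2` (Cauchy–Schwarz, Parseval,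
block count).  Coverage statement for the census §10 map: the 'Slepian-row' family and every construction on
`D + interval` is tame IN KERNEL.  Honest framing (rung currency): a Theorems-side helper `--supports` stmt-3996
covering the direct-sumset case of `stub_tameOperator`; the registered stub (all supports `S`), the engine
`stub_paleyFlatRIP` and the crux `FeketeSOSHard` stay OPEN; nothing here bears on `VP ≠ VNP`.
-/

set_option linter.dupNamespace false

namespace Summit.ValiantsHypothesis.ValiantsHypothesis.Theorems.FeketeSOSHardPaleyRIP

open Polynomial Finset
open scoped BigOperators

noncomputable section

/-! ## The direct-sumset theorem, `ℓ²` form -/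

/-- **Operator tameness on direct sumsets, `ℓ²` form.**  `k ≥ 1`; `D` with the Sidon-type spacing relative to
`[0, 2k−1)`; `S ⊇ D + [0,k)`; weighted squares `(c_i, w_i)_{i<r}` supported in `D + [0,k)` with pattern
`y = Σ_i c_i w_i²`.  Then `y = Σ_j c'_j w'_j²` with `supp w'_j ⊆ S` and
`Σ_j |c'_j|‖w'_j‖₂² ≤ √r · (Nat.log 2 k + 5/2) · (Σ_{n∈supp y} |y_n|²)^{1/2}`. [folklore] -/
theorem tameOperator_directSum_l2 (D : Finset ℕ) (k : ℕ) (hk : 1 ≤ k)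
    (hD : ∀ d₁ ∈ D, ∀ d₁' ∈ D, ∀ d₂ ∈ D, ∀ d₂' ∈ D, ∀ f₁ < 2 * k - 1, ∀ f₂ < 2 * k - 1,
      d₁ + d₁' + f₁ = d₂ + d₂' + f₂ → (d₁ = d₂ ∧ d₁' = d₂') ∨ (d₁ = d₂' ∧ d₁' = d₂))
    (S : Finset ℕ) (hS : ∀ d ∈ D, ∀ h < k, d + h ∈ S)
    (r : ℕ) (c : Fin r → ℂ) (w : Fin r → ℂ[X])
    (hw : ∀ i, (w i).support ⊆ (D ×ˢ range k).image (fun x => x.1 + x.2)) :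
    ∃ (s : ℕ) (c' : Fin s → ℂ) (w' : Fin s → ℂ[X]), (∀ j, (w' j).support ⊆ S) ∧
      (∑ j, C (c' j) * w' j ^ 2) = ∑ i, C (c i) * w i ^ 2 ∧
      (∑ j, sqMass (c' j) (w' j)) ≤ Real.sqrt r * ((Nat.log 2 k : ℝ) + 5 / 2) *
        Real.sqrt (∑ n ∈ (∑ i, C (c i) * w i ^ 2).support, ‖(∑ i, C (c i) * w i ^ 2).coeff n‖ ^ 2) := by
  have hN : 0 < 2 * k - 1 := by omega
  have hζ := Complex.isPrimitiveRoot_exp (2 * k - 1) hN.ne'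
  have hdirect := direct_of_sidon D k hD
  refine rep_congr rfl ?_ (directSum_rep_frobenius D k hk hdirect S hS r c w hw _ (fun _ _ => rfl) _ hζ)
  exact mul_le_mul_of_nonneg_left (frobenius_sum_le_l2 D k hk hD r c w hw _ (fun _ _ => rfl) _ hζ)
    (by positivity)

/-! ## From `ℓ²` to `#S · sup` -/

/-- The pattern of squares supported in `S` is supported in `S + S`, so `#supp y ≤ #S²`. [folklore] -/
theorem card_support_pattern_le (S : Finset ℕ) (r : ℕ) (c : Fin r → ℂ) (w : Fin r → ℂ[X])
    (hw : ∀ i, (w i).support ⊆ S) :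
    ((∑ i, C (c i) * w i ^ 2).support.card : ℝ) ≤ (S.card : ℝ) ^ 2 := by
  classical
  have hsub : (∑ i, C (c i) * w i ^ 2).support ⊆ (S ×ˢ S).image (fun x => x.1 + x.2) := by
    intro n hn
    rw [mem_support_iff, finsetSum_coeff] at hn
    obtain ⟨i, -, hi⟩ := Finset.exists_ne_zero_of_sum_ne_zero hn
    rw [coeff_C_mul, pow_two] at hi
    have hi' : (w i * w i).coeff n ≠ 0 := fun h => hi (by rw [h, mul_zero])
    exact support_mul_subset_image (hw i) (hw i) (mem_support_iff.2 hi')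
  calc ((∑ i, C (c i) * w i ^ 2).support.card : ℝ)
      ≤ (((S ×ˢ S).image (fun x => x.1 + x.2)).card : ℝ) := by exact_mod_cast Finset.card_le_card hsub
    _ ≤ ((S ×ˢ S).card : ℝ) := by exact_mod_cast Finset.card_image_le
    _ = (S.card : ℝ) ^ 2 := by rw [Finset.card_product]; push_cast; ring

/-- `‖y‖₂ ≤ #S · M` when `supp y ⊆ S + S` and `|y_n| ≤ M` on `supp y`. [folklore] -/
theorem l2_le_card_mul_sup (S : Finset ℕ) (r : ℕ) (c : Fin r → ℂ) (w : Fin r → ℂ[X])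
    (hw : ∀ i, (w i).support ⊆ S) (M : ℝ) (hM0 : 0 ≤ M)
    (hM : ∀ n ∈ (∑ i, C (c i) * w i ^ 2).support, ‖(∑ i, C (c i) * w i ^ 2).coeff n‖ ≤ M) :
    Real.sqrt (∑ n ∈ (∑ i, C (c i) * w i ^ 2).support, ‖(∑ i, C (c i) * w i ^ 2).coeff n‖ ^ 2) ≤
      (S.card : ℝ) * M := by
  have hcard := card_support_pattern_le S r c w hw
  have hsum : (∑ n ∈ (∑ i, C (c i) * w i ^ 2).support, ‖(∑ i, C (c i) * w i ^ 2).coeff n‖ ^ 2) ≤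
      ((S.card : ℝ) * M) ^ 2 := by
    refine (Finset.sum_le_sum fun n hn => pow_le_pow_left₀ (norm_nonneg _) (hM n hn) 2).trans ?_
    rw [Finset.sum_const, nsmul_eq_mul, mul_pow]
    exact mul_le_mul_of_nonneg_right hcard (sq_nonneg _)
  calc Real.sqrt _ ≤ Real.sqrt (((S.card : ℝ) * M) ^ 2) := Real.sqrt_le_sqrt hsum
    _ = (S.card : ℝ) * M := Real.sqrt_sq (by positivity)

/-- **Operator tameness on direct sumsets, `sup` form**: as `tameOperator_directSum_l2` with the bound
`√r · (Nat.log 2 k + 5/2) · #S · M` whenever `|y_n| ≤ M` for all `n` (`S = D + [0,k)`). [folklore] -/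
theorem tameOperator_directSum_sup (D : Finset ℕ) (k : ℕ) (hk : 1 ≤ k)
    (hD : ∀ d₁ ∈ D, ∀ d₁' ∈ D, ∀ d₂ ∈ D, ∀ d₂' ∈ D, ∀ f₁ < 2 * k - 1, ∀ f₂ < 2 * k - 1,
      d₁ + d₁' + f₁ = d₂ + d₂' + f₂ → (d₁ = d₂ ∧ d₁' = d₂') ∨ (d₁ = d₂' ∧ d₁' = d₂))
    (r : ℕ) (c : Fin r → ℂ) (w : Fin r → ℂ[X])
    (hw : ∀ i, (w i).support ⊆ (D ×ˢ range k).image (fun x => x.1 + x.2)) (M : ℝ)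
    (hM : ∀ n, ‖(∑ i, C (c i) * w i ^ 2).coeff n‖ ≤ M) :
    ∃ (s : ℕ) (c' : Fin s → ℂ) (w' : Fin s → ℂ[X]),
      (∀ j, (w' j).support ⊆ (D ×ˢ range k).image (fun x => x.1 + x.2)) ∧
      (∑ j, C (c' j) * w' j ^ 2) = ∑ i, C (c i) * w i ^ 2 ∧
      (∑ j, sqMass (c' j) (w' j)) ≤ Real.sqrt r * ((Nat.log 2 k : ℝ) + 5 / 2) *
        (((D ×ˢ range k).image (fun x => x.1 + x.2)).card : ℝ) * M := by
  have hM0 : 0 ≤ M := (norm_nonneg _).trans (hM 0)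
  have hS : ∀ d ∈ D, ∀ h < k, d + h ∈ (D ×ˢ range k).image (fun x => x.1 + x.2) := fun d hd h hh =>
    Finset.mem_image.2 ⟨(d, h), Finset.mem_product.2 ⟨hd, mem_range.2 hh⟩, rfl⟩
  refine rep_congr rfl ?_ (tameOperator_directSum_l2 D k hk hD _ hS r c w hw)
  rw [mul_assoc (Real.sqrt r * _)]
  exact mul_le_mul_of_nonneg_left (l2_le_card_mul_sup _ r c w hw M hM0 fun n _ => hM n) (by positivity)

/-! ## Cyclic patterns: the stub's vocabulary -/

/-- `L_z(f) = Σ_{e ∈ supp f} z(e) f_e`. [folklore] -/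
theorem ztwist_eq_sum_support (p : ℕ) [Fact p.Prime] (z : ZMod p → ℂ) (f : ℂ[X]) :
    (Polynomial.lsum (fun e : ℕ => (z (e : ZMod p)) • (LinearMap.id : ℂ →ₗ[ℂ] ℂ)) : ℂ[X] →ₗ[ℂ] ℂ) f =
      ∑ e ∈ f.support, z (e : ZMod p) * f.coeff e := by
  conv_lhs => rw [as_sum_support_C_mul_X_pow f]
  rw [map_sum]
  exact Finset.sum_congr rfl fun e _ => ztwist_C_mul_X_pow p z _ _

/-- **Coefficients of a cyclic reduction**: if `deg F < p` and `X^p − 1 ∣ y − F` then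
`F_ν = Σ_{e ∈ supp y, e ≡ ν (p)} y_e` for every residue `ν`. [folklore] -/
theorem coeff_cyclic_eq_sum_support (p : ℕ) [Fact p.Prime] (y F : ℂ[X]) (hF : F.natDegree < p)
    (hdvd : (X : ℂ[X]) ^ p - 1 ∣ y - F) (ν : ZMod p) :
    F.coeff ν.val = ∑ e ∈ y.support, if (e : ZMod p) = ν then y.coeff e else 0 := by
  classical
  have h0 := ztwist_eq_zero_of_dvd p (fun m => if m = ν then 1 else 0) hdvd
  rw [map_sub, sub_eq_zero, ztwist_eq_sum_support p (fun m => if m = ν then 1 else 0) y,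
    ztwist_of_natDegree_lt p (fun m => if m = ν then 1 else 0) hF] at h0
  have hl : ∑ m ∈ range p, (if ((m : ℕ) : ZMod p) = ν then (1 : ℂ) else 0) * F.coeff m = F.coeff ν.val := by
    rw [Finset.sum_eq_single ν.val]
    · rw [if_pos (ZMod.natCast_zmod_val ν), one_mul]
    · intro m hm hne
      rw [if_neg, zero_mul]
      intro h
      apply hne
      rw [← h, ZMod.val_natCast, Nat.mod_eq_of_lt (mem_range.1 hm)]
    · intro h
      exact absurd (mem_range.2 (ZMod.val_lt ν)) h
  rw [← hl, ← h0]
  refine Finset.sum_congr rfl fun e _ => ?_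
  split_ifs <;> simp

/-- **`stub_tameOperator` on direct sumsets (cyclic form, the stub's vocabulary).**  Let `p` be prime, `k ≥ 1`,
and let `D` have the Sidon-type spacing relative to `[0, 2k−1)` MODULO `p`: the residues `d + d' + f (mod p)`
(`{d,d'} ⊆ D`, `f < 2k − 1`) are distinct up to the swap `d ↔ d'` (no wrap-around); `S = D + [0,k)`.  If
`(c_i, w_i)_{i<r}` are weighted squares supported in `S`, `deg F < p`, `X^p − 1 ∣ Σ_i c_i w_i² − F` and
`|F_n| ≤ M` for all `n`, then there are weighted squares `(c'_j, w'_j)` supported in `S` with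
`X^p − 1 ∣ Σ_j c'_j w'_j² − F` and `Σ_j |c'_j|·‖w'_j‖₂² ≤ √r · (Nat.log 2 k + 5/2) · #S · M` — the conclusion
of `stub_tameOperator` on these supports with exponent `1` and constant `√r (log₂ k + 5/2)`. [folklore] -/
theorem tameOperator_of_directSum (p : ℕ) [Fact p.Prime] (D : Finset ℕ) (k : ℕ) (hk : 1 ≤ k)
    (hD : ∀ d₁ ∈ D, ∀ d₁' ∈ D, ∀ d₂ ∈ D, ∀ d₂' ∈ D, ∀ f₁ < 2 * k - 1, ∀ f₂ < 2 * k - 1,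
      ((d₁ + d₁' + f₁ : ℕ) : ZMod p) = ((d₂ + d₂' + f₂ : ℕ) : ZMod p) →
        ((d₁ = d₂ ∧ d₁' = d₂') ∨ (d₁ = d₂' ∧ d₁' = d₂)) ∧ f₁ = f₂)
    (r : ℕ) (c : Fin r → ℂ) (w : Fin r → ℂ[X])
    (hw : ∀ i, (w i).support ⊆ (D ×ˢ range k).image (fun x => x.1 + x.2))
    (F : ℂ[X]) (M : ℝ) (hF : F.natDegree < p)
    (hdvd : (X : ℂ[X]) ^ p - 1 ∣ (∑ i, C (c i) * w i ^ 2) - F) (hM : ∀ n, ‖F.coeff n‖ ≤ M) :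
    ∃ (s' : ℕ) (c' : Fin s' → ℂ) (w' : Fin s' → ℂ[X]),
      (∀ j, (w' j).support ⊆ (D ×ˢ range k).image (fun x => x.1 + x.2)) ∧
      ((X : ℂ[X]) ^ p - 1 ∣ (∑ j, C (c' j) * w' j ^ 2) - F) ∧
      (∑ j, sqMass (c' j) (w' j)) ≤ Real.sqrt r * ((Nat.log 2 k : ℝ) + 5 / 2) *
        (((D ×ˢ range k).image (fun x => x.1 + x.2)).card : ℝ) * M := by
  classical
  have hM0 : 0 ≤ M := (norm_nonneg _).trans (hM 0)
  -- the spacing in `ℕ` follows from the spacing mod `p`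
  have hDN : ∀ d₁ ∈ D, ∀ d₁' ∈ D, ∀ d₂ ∈ D, ∀ d₂' ∈ D, ∀ f₁ < 2 * k - 1, ∀ f₂ < 2 * k - 1,
      d₁ + d₁' + f₁ = d₂ + d₂' + f₂ → (d₁ = d₂ ∧ d₁' = d₂') ∨ (d₁ = d₂' ∧ d₁' = d₂) :=
    fun d₁ h₁ d₁' h₁' d₂ h₂ d₂' h₂' f₁ hf₁ f₂ hf₂ h =>
      (hD d₁ h₁ d₁' h₁' d₂ h₂ d₂' h₂' f₁ hf₁ f₂ hf₂ (by rw [h])).1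
  have hdirect := direct_of_sidon D k hDN
  have hS : ∀ d ∈ D, ∀ h < k, d + h ∈ (D ×ˢ range k).image (fun x => x.1 + x.2) := fun d hd h hh =>
    Finset.mem_image.2 ⟨(d, h), Finset.mem_product.2 ⟨hd, mem_range.2 hh⟩, rfl⟩
  -- every exponent of the pattern is some `d + d' + f`
  have hmem : ∀ n ∈ (∑ i, C (c i) * w i ^ 2).support, ∃ d ∈ D, ∃ d' ∈ D, ∃ f < 2 * k - 1,
      n = d + d' + f := by
    intro n hn
    have h := coeff_pattern_eq_fiber_sum D k hk hdirect r c w hw _ (fun _ _ => rfl) n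
    have hne := mem_support_iff.1 hn
    rw [h] at hne
    obtain ⟨t, ht, -⟩ := Finset.exists_ne_zero_of_sum_ne_zero hne
    rw [Finset.mem_filter, Finset.mem_product, Finset.mem_product, mem_range] at ht
    exact ⟨t.1.1, ht.1.1.1, t.1.2, ht.1.1.2, t.2, ht.1.2, ht.2.symm⟩
  -- two exponents of the pattern that agree mod `p` are equal
  have hinj : ∀ n ∈ (∑ i, C (c i) * w i ^ 2).support, ∀ e ∈ (∑ i, C (c i) * w i ^ 2).support,
      ((e : ℕ) : ZMod p) = ((n : ℕ) : ZMod p) → e = n := by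
    intro n hn e he hcast
    obtain ⟨d₁, h₁, d₁', h₁', f₁, hf₁, rfl⟩ := hmem e he
    obtain ⟨d₂, h₂, d₂', h₂', f₂, hf₂, rfl⟩ := hmem n hn
    obtain ⟨hdd, hf⟩ := hD d₁ h₁ d₁' h₁' d₂ h₂ d₂' h₂' f₁ hf₁ f₂ hf₂ hcast
    rcases hdd with ⟨rfl, rfl⟩ | ⟨rfl, rfl⟩ <;> omega
  -- hence `|y_n| = |F_{n mod p}| ≤ M` on the support of the pattern `y`
  have hyM : ∀ n ∈ (∑ i, C (c i) * w i ^ 2).support, ‖(∑ i, C (c i) * w i ^ 2).coeff n‖ ≤ M := by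
    intro n hn
    have h := coeff_cyclic_eq_sum_support p _ F hF hdvd ((n : ℕ) : ZMod p)
    rw [Finset.sum_eq_single_of_mem n hn fun e he hne => if_neg fun hcast => hne (hinj n hn e he hcast),
      if_pos rfl] at h
    rw [← h]
    exact hM _
  obtain ⟨s', c', w', hsupp, heq, hmass⟩ := tameOperator_directSum_l2 D k hk hDN _ hS r c w hw
  refine ⟨s', c', w', hsupp, ?_, hmass.trans ?_⟩
  · rw [heq]; exact hdvd
  · rw [mul_assoc (Real.sqrt r * _)]
    exact mul_le_mul_of_nonneg_left (l2_le_card_mul_sup _ r c w hw M hM0 hyM) (by positivity)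

/-- **All ranks on Sidon supports** (the case `k = 1`): if `S` is Sidon modulo `p` (as in
`tameOperator_rank_two_of_sidon`), every family of `r` weighted squares supported in `S` whose cyclic pattern `F`
(`deg F < p`) has coefficients of modulus `≤ M` is re-represented by squares supported in `S` with the same cyclic
pattern and mass `≤ √r · (5/2) · #S · M`. [folklore] -/
theorem tameOperator_of_sidon (p : ℕ) [Fact p.Prime] (S : Finset ℕ)
    (hSidon : ∀ s ∈ S, ∀ t ∈ S, ∀ s' ∈ S, ∀ t' ∈ S,
      ((s + t : ℕ) : ZMod p) = ((s' + t' : ℕ) : ZMod p) → (s = s' ∧ t = t') ∨ (s = t' ∧ t = s'))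
    (r : ℕ) (c : Fin r → ℂ) (w : Fin r → ℂ[X]) (hw : ∀ i, (w i).support ⊆ S)
    (F : ℂ[X]) (M : ℝ) (hF : F.natDegree < p)
    (hdvd : (X : ℂ[X]) ^ p - 1 ∣ (∑ i, C (c i) * w i ^ 2) - F) (hM : ∀ n, ‖F.coeff n‖ ≤ M) :
    ∃ (s' : ℕ) (c' : Fin s' → ℂ) (w' : Fin s' → ℂ[X]), (∀ j, (w' j).support ⊆ S) ∧
      ((X : ℂ[X]) ^ p - 1 ∣ (∑ j, C (c' j) * w' j ^ 2) - F) ∧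
      (∑ j, sqMass (c' j) (w' j)) ≤ Real.sqrt r * (5 / 2) * (S.card : ℝ) * M := by
  classical
  have himg : (S ×ˢ range 1).image (fun x : ℕ × ℕ => x.1 + x.2) = S := by
    ext n
    simp only [Finset.mem_image, Finset.mem_product, Finset.mem_range, Nat.lt_one_iff, Prod.exists]
    constructor
    · rintro ⟨a, b, ⟨ha, rfl⟩, rfl⟩
      simpa using ha
    · intro hn
      exact ⟨n, 0, ⟨hn, rfl⟩, by simp⟩
  have hD : ∀ d₁ ∈ S, ∀ d₁' ∈ S, ∀ d₂ ∈ S, ∀ d₂' ∈ S, ∀ f₁ < 2 * 1 - 1, ∀ f₂ < 2 * 1 - 1,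
      ((d₁ + d₁' + f₁ : ℕ) : ZMod p) = ((d₂ + d₂' + f₂ : ℕ) : ZMod p) →
        ((d₁ = d₂ ∧ d₁' = d₂') ∨ (d₁ = d₂' ∧ d₁' = d₂)) ∧ f₁ = f₂ := by
    intro d₁ h₁ d₁' h₁' d₂ h₂ d₂' h₂' f₁ hf₁ f₂ hf₂ h
    have hf₁0 : f₁ = 0 := by omega
    have hf₂0 : f₂ = 0 := by omega
    subst hf₁0 hf₂0
    exact ⟨hSidon d₁ h₁ d₁' h₁' d₂ h₂ d₂' h₂' (by simpa using h), rfl⟩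
  have hw' : ∀ i, (w i).support ⊆ (S ×ˢ range 1).image (fun x : ℕ × ℕ => x.1 + x.2) := fun i => by
    rw [himg]; exact hw i
  obtain ⟨s', c', w', hsupp, hdvd', hmass⟩ := tameOperator_of_directSum p S 1 le_rfl hD r c w hw' F M hF hdvd hM
  refine ⟨s', c', w', fun j => by rw [← himg]; exact hsupp j, hdvd', hmass.trans (le_of_eq ?_)⟩
  rw [himg, Nat.log_one_right]
  push_cast
  ring

end

end Summit.ValiantsHypothesis.ValiantsHypothesis.Theorems.FeketeSOSHardPaleyRIP
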